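import Literature.NumberTheory.EllipticCurves.Greenberg1999.LocalH1DivisibleCyclotomicProofs
import Literature.NumberTheory.EllipticCurves.AnticyclotomicInertiaAboveP
import Literature.NumberTheory.EllipticCurves.GreenbergSelmer
import Literature.NumberTheory.GaloisRepresentations.DecompositionGroupRelSlim
import HarnessLib

/-!
# `cd_p ≤ 1` for the decomposition groups of `K_∞` above `v̄` (any `ℤ_p`-extension in which `v̄` does not
# split completely; the anticyclotomic one at `v̄ ∣ p`) and its two consequences: local `p`-DIVISIBILITY of
# `H¹` (DIV_loc) and local RESIDUAL SURJECTIVITY `H¹(·, N₂) ↠ H¹(·, N₃)` (LRS_loc)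
# (cell `bsd-eis`, seat `bsd-line-x1-p1-w4` gen 3, D-0154 WIDTH PASS; crux 2 `GoodLatticeBDPValue`
# stmt-BirchSwinnertonDyer-19032, line `halves` v19.1, V21 INDEX ROAD §4 S3 `stub_localDivisible` +
# `stub_localResidualSurj` of LEAD g4's memo `Cruxes/GoodLatticeBDPValue/Lines/halves-imprimLambda-index-road.md`)

HONEST FRAMING (cell `bsd-eis`, run/shared/lean/pub/bsd-eis/): Galois-cohomology bookkeeping on constructed
objects; no definition, no named fact, no `sorry`, no `Theses` import; nothing about any curve is asserted;
BSD / IMC2 / KY Thm. 1.4.1 are proved for NO curve. Helper `--supports stmt-BirchSwinnertonDyer-19032`.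

## Why
Steps (1) and (3) of the V21 index road need, at each place `w_j` of `K_∞` above `v̄`, DIV_loc
`H¹(G_j, A)/p = 0` (`A` `p`-divisible) and LRS_loc `H¹(G_j, E[p]) ↠ H¹(G_j, 𝔽(𝟙̃))`; both follow from
`cd_p(G_j) ≤ 1`, `G_j = Gal(K̄_{v̄}/K_{∞,w_j})`, which holds because `K_{∞,w}/K_v̄` is a `ℤ_p`-extension
(Serre CG II §3.3 Prop. 9; tree `groupCdLE_one_ker_of_apply_ne_one`). The tree's template is the CYCLOTOMIC
discharge `Greenberg1999.localH1_primaryTorsion_divisible_cyclotomic_holds` (b2b) for `E(K̄_v)[p^∞]`; here: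

* §1 (generic compact `Γ` with `cd_p(Γ) ≤ 1`, explicit-cocycle currency `discreteH1` / `resH1Hom`):
  `exists_eq_nsmul_of_groupCdLE_one` — every class of `H¹(Γ, M)` is a `p`-th multiple when `M` is a
  `p`-divisible discrete `Γ`-module with continuous orbit maps (Greenberg LNM 1716 Lemma 4.5, `n = 1`);
  `resH1Hom_id_surjective_of_groupCdLE_one` — `q_* : H¹(Γ, N₂) → H¹(Γ, N₃)` is onto for an exact
  `0 → N₁ → N₂ → N₃ → 0` of discrete `Γ`-modules with `N₁` `p`-primary (`δ₁` lands in `H²(Γ, N₁) = 0`).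
* §2 `cd_p ≤ 1`: for ANY `ℤ_p`-extension `κ` of a number field `K` and ANY finite `v` with some `τ ∈ D_v`,
  `κ τ ≠ 1` ("`v` does not split completely in `K_∞`"): `cd_p ≤ 1` for the local group
  `(ker κ)_v = localSubgroup κ.kerSubgroup K_v ≤ Γ_{K_v}` AND for the decomposition subgroup
  `ker κ ⊓ D_v ≤ Γ_K` of the cell's `K_∞`-currency (`resOfLe … (ker κ ⊓ decomp v̄ ≤ ker κ)`), the two being
  isomorphic topological groups under the injective restriction `Γ_{K_v} → Γ_K`
  (`continuousMulEquiv_localSubgroup_inf_decomp`); the anticyclotomic instance at `v ∣ p` (`K` imaginary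
  quadratic, `p` odd) from `exists_mem_inertia_apply_ne_one_of_isAnticyclotomic`.
* §3 the two road inputs for `Γ := ker κ ⊓ D_v̄` (compact): DIV_loc and LRS_loc by §1 + §2.

NOT here: the same at the CONJUGATE places `w_j = τ_j w_0` — not needed separately (the cell's device tests
`conj_{τ_j} c` on the ONE subgroup `ker κ ⊓ D_v̄`); FIN_loc (w2 gen 3, brick (f)); SUR at `v̄` (S1/S2).

References: [SerreGaloisCohomology1997] II §3.3 Prop. 9, I §2.2; [GreenbergLNM1716] §4 Lemma 4.5 and the
paragraph after it, §2 proof of Prop. 2.4; [NeukirchANT1999] II §9 Prop. (9.6); [KellerYin2024] §1.1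
(`H¹(K_{∞,w}, ·)`, arXiv:2402.12781v2).
-/

set_option autoImplicit false
set_option linter.dupNamespace false -- the summit namespace `…BirchSwinnertonDyer.BirchSwinnertonDyer.Theorems` (Sub = Summit, D-0017) trips it

noncomputable section

open scoped Classical

namespace Summit.BirchSwinnertonDyer.BirchSwinnertonDyer.Theorems.AnticyclotomicLocalCdOne

open CategoryTheory Function NumberField IsDedekindDomain Field
open Literature.NumberTheory.GaloisRepresentations Literature.NumberTheory.EllipticCurves
  Literature.NumberTheory.EllipticCurves.GreenbergSelmer

/-! ### §1 Consequences of `cd_p(Γ) ≤ 1` for discrete modules (explicit-cocycle currency) -/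

section Generic

variable {p : ℕ}
variable {Γ : Type} [Group Γ] [TopologicalSpace Γ] [IsTopologicalGroup Γ] [CompactSpace Γ]

/-- **DIV: every class of `H¹(Γ, M)` is a `p`-th multiple** when `cd_p(Γ) ≤ 1` and `M` is a `p`-divisible
discrete `Γ`-module with continuous orbit maps: the sequence `0 → M[p] → M →ᵖ M → 0` is short exact,
`H¹(p) = p`, and `H²(Γ, M[p]) = 0` (`M[p]` is `p`-primary), so exactness at `H¹(Γ, M)` gives the claim
(Greenberg, LNM 1716, Lemma 4.5 with `n = 1`; template `Greenberg1999.localH1_primaryTorsion_divisible_cyclotomic_holds`).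
[cite: GreenbergLNM1716, §4 Lemma 4.5] [cite: SerreGaloisCohomology1997, I §2.2] -/
theorem exists_eq_nsmul_of_groupCdLE_one {M : Type} [AddCommGroup M] [DistribMulAction Γ M]
    [TopologicalSpace M] [DiscreteTopology M] (hcont : ∀ m : M, Continuous fun g : Γ ↦ g • m)
    (hcd : GroupCdLE Γ p 1) (hdiv : ∀ m : M, ∃ m' : M, p • m' = m) (c : discreteH1 Γ M) :
    ∃ c' : discreteH1 Γ M, c = p • c' := by
  -- `M` as a `ContinuousRep` (definitionally the tree's `discreteTopRep`)
  let ρM : ContinuousRep Γ ℤ M :=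
    { toRepresentation := (discreteContRep Γ M).toRepresentation
      continuous_smul := continuous_prod_of_discrete_right.mpr hcont }
  have hρM : ρM.toTopRep = discreteTopRep Γ M := rfl
  have hρMap : ∀ (σ : Γ) (m : M), ρM σ m = σ • m := fun _ _ ↦ rfl
  -- the `p`-torsion subrepresentation and the two morphisms
  let T : Submodule ℤ M := Submodule.torsionBy ℤ M (p : ℤ)
  have hT : ∀ σ : Γ, T ≤ T.comap (ρM σ) := by
    intro σ m hm
    rw [Submodule.mem_comap, Submodule.mem_torsionBy_iff, ← map_smul,
      (Submodule.mem_torsionBy_iff (p : ℤ) m).1 hm, map_zero]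
  let ρT : ContinuousRep Γ ℤ T := ρM.subrepresentation T hT
  let ι : ρT.toTopRep ⟶ ρM.toTopRep :=
    TopRep.ofHom ⟨⟨T.subtype, continuous_subtype_val⟩, fun σ ↦ by ext m; rfl⟩
  let π : ρM.toTopRep ⟶ ρM.toTopRep :=
    TopRep.ofHom ⟨⟨(p : ℤ) • LinearMap.id, continuous_of_discreteTopology⟩, fun σ ↦ by
      apply ContinuousLinearMap.ext
      intro m
      change (p : ℤ) • (ρM σ m) = ρM σ ((p : ℤ) • m)
      rw [map_smul]⟩
  have hdiv' : Function.Surjective fun m : M ↦ (p : ℤ) • m := by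
    intro m
    obtain ⟨m', hm'⟩ := hdiv m
    exact ⟨m', by change (p : ℤ) • m' = m; rw [natCast_zsmul, hm']⟩
  have hSES : IsSES ι π :=
    { comp_eq_zero := by
        ext m
        exact (Submodule.mem_torsionBy_iff (p : ℤ) (m : M)).1 m.2
      injective := Subtype.val_injective
      exact_mid := fun y hy ↦ ⟨⟨y, (Submodule.mem_torsionBy_iff (p : ℤ) y).2 hy⟩, rfl⟩
      surjective := hdiv' }
  -- `H¹(π) = p`
  have hπ : ∀ y : continuousCohomology 1 ρM.toTopRep, cohomologyMap π 1 y = p • y := by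
    intro y
    obtain ⟨ψ, rfl⟩ := oneCocycleClass_surjective ρM.toTopRep y
    rw [cohomologyMap_oneCocycleClass, ← Nat.cast_smul_eq_nsmul ℤ p]
    have h1 : contOneCocycles.pullback (ContinuousMonoidHom.id _) (resIdHom π) ψ = (p : ℤ) • ψ :=
      Subtype.ext (ContinuousMap.ext fun σ ↦ rfl)
    rw [h1]
    exact oneCocycleClass_smul (X := ρM.toTopRep) (p : ℤ) ψ
  -- `H²(Γ, M[p]) = 0` from `cd_p(Γ) ≤ 1`
  have hTp : IsPrimaryTorsion p T := fun t ↦ ⟨1, by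
    apply Subtype.ext
    rw [pow_one]
    change ((p • t : T) : M) = 0
    rw [Submodule.coe_smul_of_tower, ← natCast_zsmul]
    exact (Submodule.mem_torsionBy_iff (p : ℤ) (t : M)).1 t.2⟩
  have h2 : Subsingleton (continuousCohomology 2 ρT.toTopRep) := hcd T ρT hTp (by norm_num : 1 < 2)
  obtain ⟨c', hc'⟩ := exists_eq_nsmul_of_isSES_of_subsingleton_two hSES hπ h2 c
  exact ⟨c', hc'⟩

variable {N₁ : Type} [AddCommGroup N₁] [DistribMulAction Γ N₁] [TopologicalSpace N₁] [DiscreteTopology N₁]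
variable {N₂ : Type} [AddCommGroup N₂] [DistribMulAction Γ N₂] [TopologicalSpace N₂] [DiscreteTopology N₂]
variable {N₃ : Type} [AddCommGroup N₃] [DistribMulAction Γ N₃] [TopologicalSpace N₃] [DiscreteTopology N₃]

/-- **LRS: `q_* : H¹(Γ, N₂) → H¹(Γ, N₃)` is onto** when `cd_p(Γ) ≤ 1`, for an exact sequence
`0 → N₁ —j→ N₂ —q→ N₃ → 0` of discrete `Γ`-modules with continuous orbit maps and `N₁` `p`-primary:
the connecting map `δ₁ : H¹(Γ, N₃) → H²(Γ, N₁) = 0` vanishes (tree `IsSES.exists_map_one_eq_of_δ₁_eq_zero`),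
and the IsSES map `H¹(q)` is the tree's `resH1Hom (id) q` on classes (`[φ] ↦ [q ∘ φ]`).
[cite: SerreGaloisCohomology1997, I §2.2 (Prop. 2)] [cite: GreenbergLNM1716, §2 (proof of Prop. 2.4)] -/
theorem resH1Hom_id_surjective_of_groupCdLE_one (hcd : GroupCdLE Γ p 1)
    (hcont₁ : ∀ n : N₁, Continuous fun g : Γ ↦ g • n) (hcont₂ : ∀ n : N₂, Continuous fun g : Γ ↦ g • n)
    (hcont₃ : ∀ n : N₃, Continuous fun g : Γ ↦ g • n)
    (hN₁ : ∀ n : N₁, ∃ k : ℕ, p ^ k • n = 0)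
    (j : N₁ →+ N₂) (hj : ∀ (g : Γ) (n : N₁), j (g • n) = g • j n) (hinj : Function.Injective j)
    (q : N₂ →+ N₃) (hq : ∀ (g : Γ) (n : N₂), q (ContinuousMonoidHom.id Γ g • n) = g • q n)
    (hqj : ∀ n : N₁, q (j n) = 0) (hexact : ∀ n : N₂, q n = 0 → ∃ m : N₁, j m = n)
    (hsurj : Function.Surjective q) :
    Function.Surjective (resH1Hom (ContinuousMonoidHom.id Γ) q hq) := by
  -- the three `ContinuousRep`s (definitionally the tree's `discreteTopRep`s)
  let ρ₁ : ContinuousRep Γ ℤ N₁ :=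
    { toRepresentation := (discreteContRep Γ N₁).toRepresentation
      continuous_smul := continuous_prod_of_discrete_right.mpr hcont₁ }
  let ρ₂ : ContinuousRep Γ ℤ N₂ :=
    { toRepresentation := (discreteContRep Γ N₂).toRepresentation
      continuous_smul := continuous_prod_of_discrete_right.mpr hcont₂ }
  let ρ₃ : ContinuousRep Γ ℤ N₃ :=
    { toRepresentation := (discreteContRep Γ N₃).toRepresentation
      continuous_smul := continuous_prod_of_discrete_right.mpr hcont₃ }
  let f : ρ₁.toTopRep ⟶ ρ₂.toTopRep :=
    TopRep.ofHom ⟨⟨j.toIntLinearMap, continuous_of_discreteTopology⟩, fun σ ↦ by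
      ext n; exact hj σ n⟩
  let g : ρ₂.toTopRep ⟶ ρ₃.toTopRep :=
    TopRep.ofHom ⟨⟨q.toIntLinearMap, continuous_of_discreteTopology⟩, fun σ ↦ by
      ext n; exact hq σ n⟩
  have hSES : IsSES f g :=
    { comp_eq_zero := by ext n; exact hqj n
      injective := hinj
      exact_mid := fun y hy ↦ hexact y hy
      surjective := hsurj }
  have hTp : IsPrimaryTorsion p N₁ := hN₁
  haveI h2 : Subsingleton (continuousCohomology 2 ρ₁.toTopRep) := hcd N₁ ρ₁ hTp (by norm_num : 1 < 2)
  intro x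
  obtain ⟨y, hy⟩ := hSES.exists_map_one_eq_of_δ₁_eq_zero x (Subsingleton.elim _ _)
  refine ⟨y, ?_⟩
  -- `cohomologyMap g 1` agrees with `resH1Hom (id) q hq` (both are `[φ] ↦ [q ∘ φ]`)
  obtain ⟨φ, rfl⟩ := oneCocycleClass_surjective _ y
  rw [← hy, cohomologyMap_oneCocycleClass]
  exact (resH1Hom_id_oneCocycleClass q hq φ).trans
    (congrArg _ (Subtype.ext (ContinuousMap.ext fun σ ↦ rfl)))

end Generic

/-! ### §2 `cd_p ≤ 1` for the local group of `K_∞` at a place that does not split completely -/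

section CdOne

variable {K : Type} [Field K] [NumberField K] {p : ℕ} [hp : Fact p.Prime] (κ : ZpExtension K p)
  (v : HeightOneSpectrum (𝓞 K))

/-- **`cd_p((ker κ)_v) ≤ 1` whenever `v` does not split completely in `K_∞`**: if `κ τ ≠ 1` for some
`τ ∈ D_v`, then `(ker κ)_v = ker(κ ∘ res_v) ≤ Γ_{K_v}` is the kernel of a NON-trivial continuous
homomorphism `Γ_{K_v} → ℤ_p`, and `groupCdLE_one_ker_of_apply_ne_one` applies (Serre CG II §3.3 Prop. 9:
`p^∞ ∣ [K_{∞,w} : K_v]`). The cyclotomic case is the tree's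
`Greenberg1999.groupCdLE_one_localSubgroup_kerSubgroup_of_isCyclotomic`. [cite: SerreGaloisCohomology1997, II §3.3 Prop. 9]
[cite: GreenbergLNM1716, §2 (proof of Prop. 2.4), §4 (after Lemma 4.5)] -/
theorem groupCdLE_one_localSubgroup_kerSubgroup_of_apply_ne_one
    (hne : ∃ τ ∈ decomp v, κ τ ≠ 1) :
    GroupCdLE (localSubgroup κ.kerSubgroup (v.adicCompletion K)) p 1 := by
  haveI : CharZero (v.adicCompletion K) := LocalField.charZero_adicCompletion v
  set φ : absoluteGaloisGroup (v.adicCompletion K) →ₜ* Multiplicative ℤ_[p] :=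
    κ.toContinuousMonoidHom.comp (resGal (K := K) (v.adicCompletion K)) with hφdef
  have hker : localSubgroup κ.kerSubgroup (v.adicCompletion K) = φ.toMonoidHom.ker := by
    ext σ
    rw [mem_localSubgroup_iff, ZpExtension.mem_kerSubgroup, MonoidHom.mem_ker]
    rfl
  have hφ : ∃ σ, φ σ ≠ 1 := by
    obtain ⟨τ, hτ, hκτ⟩ := hne
    obtain ⟨σ, rfl⟩ := (mem_decomp_iff v τ).mp hτ
    exact ⟨σ, hκτ⟩
  rw [hker]
  exact groupCdLE_one_ker_of_apply_ne_one (v.adicCompletion K) φ hφ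

/-- `(ker κ)_v` is compact (closed in the profinite `Γ_{K_v}`). [folklore] -/
theorem compactSpace_localSubgroup_kerSubgroup :
    CompactSpace (localSubgroup κ.kerSubgroup (v.adicCompletion K)) := by
  haveI : CompactSpace (absoluteGaloisGroup (v.adicCompletion K)) :=
    absoluteGaloisGroup_compactSpace (v.adicCompletion K)
  have hclosed : IsClosed ((localSubgroup κ.kerSubgroup (v.adicCompletion K) :
      Subgroup (absoluteGaloisGroup (v.adicCompletion K))) : Set (absoluteGaloisGroup (v.adicCompletion K))) := by
    rw [localSubgroup_eq_comap, Subgroup.coe_comap]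
    exact κ.isClosed_kerSubgroup.preimage (map_continuous (resGal (K := K) (v.adicCompletion K)))
  exact isCompact_iff_compactSpace.mp hclosed.isCompact

/-- **`(ker κ)_v ≅ ker κ ⊓ D_v` as topological groups**: the restriction `Γ_{K_v} → Γ_K` is injective
(`absGaloisRestrict_adicCompletion_injective`, Neukirch II (9.6)) with image `D_v`, so it induces a continuous
group isomorphism from `(ker κ)_v = res_v⁻¹(ker κ)` onto `ker κ ⊓ D_v`; a continuous bijection from a compact
group to a Hausdorff one is a homeomorphism. [cite: NeukirchANT1999, Ch. II §9 Prop. (9.6)] -/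
theorem nonempty_continuousMulEquiv_localSubgroup_inf_decomp :
    Nonempty (localSubgroup κ.kerSubgroup (v.adicCompletion K) ≃ₜ* ↥(κ.kerSubgroup ⊓ decomp v)) := by
  haveI := compactSpace_localSubgroup_kerSubgroup κ v
  let r := resGal (K := K) (v.adicCompletion K)
  have hr : ∀ σ, r σ = absGaloisRestrict K (v.adicCompletion K) σ := fun _ ↦ rfl
  -- the corestricted hom
  let f : localSubgroup κ.kerSubgroup (v.adicCompletion K) →* ↥(κ.kerSubgroup ⊓ decomp v) :=
    { toFun := fun σ ↦ ⟨r σ, Subgroup.mem_inf.mpr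
        ⟨(mem_localSubgroup_iff κ.kerSubgroup (v.adicCompletion K) σ).mp σ.2, ⟨σ, (hr σ).symm⟩⟩⟩
      map_one' := Subtype.ext (by simp)
      map_mul' := fun σ τ ↦ Subtype.ext (by simp) }
  have hfcont : Continuous f :=
    Continuous.subtype_mk ((map_continuous r).comp continuous_subtype_val) _
  have hfinj : Function.Injective f := by
    intro σ τ h
    have h' : r σ = r τ := congrArg (fun x ↦ ((x : ↥(κ.kerSubgroup ⊓ decomp v)) : absoluteGaloisGroup K)) h
    rw [hr, hr] at h'
    exact Subtype.ext (absGaloisRestrict_adicCompletion_injective K v h')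
  have hfsurj : Function.Surjective f := by
    rintro ⟨τ, hτ⟩
    obtain ⟨hτk, hτD⟩ := Subgroup.mem_inf.mp hτ
    obtain ⟨σ, rfl⟩ := (mem_decomp_iff v τ).mp hτD
    exact ⟨⟨σ, (mem_localSubgroup_iff κ.kerSubgroup (v.adicCompletion K) σ).mpr hτk⟩, Subtype.ext rfl⟩
  let e : localSubgroup κ.kerSubgroup (v.adicCompletion K) ≃ ↥(κ.kerSubgroup ⊓ decomp v) :=
    Equiv.ofBijective f ⟨hfinj, hfsurj⟩
  let eₜ : localSubgroup κ.kerSubgroup (v.adicCompletion K) ≃ₜ ↥(κ.kerSubgroup ⊓ decomp v) :=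
    Continuous.homeoOfEquivCompactToT2 (f := e) hfcont
  exact ⟨{ toMulEquiv := { toEquiv := e, map_mul' := f.map_mul }
           continuous_toFun := eₜ.continuous
           continuous_invFun := eₜ.symm.continuous }⟩

/-- **`cd_p(ker κ ⊓ D_v) ≤ 1`** (the decomposition subgroup of `Gal(K̄/K_∞)` at the chosen place above
`v`, the group of the cell's local terms `resOfLe … (ker κ ⊓ decomp v ≤ ker κ)`) whenever `v` does not
split completely in `K_∞`: transport of `groupCdLE_one_localSubgroup_kerSubgroup_of_apply_ne_one` along
the isomorphism above (`GroupCdLE.of_continuousMulEquiv`). [cite: SerreGaloisCohomology1997, II §3.3 Prop. 9]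
[cite: GreenbergLNM1716, §4 (after Lemma 4.5)] -/
theorem groupCdLE_one_kerSubgroup_inf_decomp (hne : ∃ τ ∈ decomp v, κ τ ≠ 1) :
    GroupCdLE ↥(κ.kerSubgroup ⊓ decomp v) p 1 := by
  obtain ⟨e⟩ := nonempty_continuousMulEquiv_localSubgroup_inf_decomp κ v
  exact GroupCdLE.of_continuousMulEquiv e
    (groupCdLE_one_localSubgroup_kerSubgroup_of_apply_ne_one κ v hne)

/-- `ker κ ⊓ D_v` is compact (closed in the profinite `Γ_K`). [folklore] -/
theorem compactSpace_kerSubgroup_inf_decomp : CompactSpace ↥(κ.kerSubgroup ⊓ decomp v) := by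
  obtain ⟨e⟩ := nonempty_continuousMulEquiv_localSubgroup_inf_decomp κ v
  haveI := compactSpace_localSubgroup_kerSubgroup κ v
  exact e.toHomeomorph.compactSpace

/-- **The anticyclotomic instance at `v ∣ p`**: for `K` imaginary quadratic, `p` odd, `κ` ANTICYCLOTOMIC and
`v` above `p`, some element of the INERTIA group `I_v ≤ D_v` is not killed by `κ` (`v` is ramified, in
particular not split completely, in `K_∞`: tree `exists_mem_inertia_apply_ne_one_of_isAnticyclotomic` for the
prime `𝔓₀` of the chosen embedding, `inertia_adicCompletionPrime_eq_map_absInertia`); hence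
**`cd_p(ker κ ⊓ D_v) ≤ 1`** and `cd_p((ker κ)_v) ≤ 1`. [cite: KellerYin2024, §1.1 (arXiv:2402.12781v2: "`v̄` is finitely decomposed and totally ramified above")]
[cite: SerreGaloisCohomology1997, II §3.3 Prop. 9] -/
theorem exists_mem_decomp_apply_ne_one_of_isAnticyclotomic (hK : IsImaginaryQuadratic K) (hp2 : p ≠ 2)
    (hκ : κ.IsAnticyclotomic) (hpv : ((p : ℕ) : 𝓞 K) ∈ v.asIdeal) :
    ∃ τ ∈ decomp v, κ τ ≠ 1 := by
  obtain ⟨τ, hτ, hne⟩ := ZpExtension.exists_mem_inertia_apply_ne_one_of_isAnticyclotomic hK hp2 κ hκ hpv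
    (adicCompletionPrime_mem_primesAbove K v)
  rw [inertia_adicCompletionPrime_eq_map_absInertia K v] at hτ
  obtain ⟨σ, -, rfl⟩ := Subgroup.mem_map.mp hτ
  exact ⟨_, ⟨σ, rfl⟩, hne⟩

/-- `cd_p(ker κ ⊓ D_v̄) ≤ 1` for the anticyclotomic `ℤ_p`-extension at `v̄ ∣ p` (`K` imaginary quadratic,
`p` odd). [cite: SerreGaloisCohomology1997, II §3.3 Prop. 9] [cite: GreenbergLNM1716, §4 (after Lemma 4.5)] -/
theorem groupCdLE_one_kerSubgroup_inf_decomp_of_isAnticyclotomic (hK : IsImaginaryQuadratic K)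
    (hp2 : p ≠ 2) (hκ : κ.IsAnticyclotomic) (hpv : ((p : ℕ) : 𝓞 K) ∈ v.asIdeal) :
    GroupCdLE ↥(κ.kerSubgroup ⊓ decomp v) p 1 :=
  groupCdLE_one_kerSubgroup_inf_decomp κ v
    (exists_mem_decomp_apply_ne_one_of_isAnticyclotomic κ v hK hp2 hκ hpv)

end CdOne

/-! ### §3 DIV_loc and LRS_loc for `ker κ ⊓ D_v` -/

section Road

variable {K : Type} [Field K] [NumberField K] {p : ℕ} [hp : Fact p.Prime] (κ : ZpExtension K p)
  (v : HeightOneSpectrum (𝓞 K))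

/-- **DIV_loc — `H¹(ker κ ⊓ D_v, M)` is `p`-divisible** for every `p`-divisible discrete `Γ_K`-module `M`
with continuous orbit maps (e.g. `E[p^∞]`, `(F/𝒪)(θ)`), at every finite `v` that does not split completely
in `K_∞` (anticyclotomic `v̄ ∣ p`: `exists_mem_decomp_apply_ne_one_of_isAnticyclotomic`). V21 index road,
step (1): `P(A)/p = 0`. [cite: GreenbergLNM1716, §4 Lemma 4.5 and the paragraph after it]
[cite: SerreGaloisCohomology1997, II §3.3 Prop. 9] -/
theorem exists_eq_nsmul_subgroupH1_inf_decomp (hne : ∃ τ ∈ decomp v, κ τ ≠ 1)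
    {M : Type} [AddCommGroup M] [DistribMulAction (absoluteGaloisGroup K) M] [TopologicalSpace M]
    [DiscreteTopology M] (hcont : ∀ m : M, Continuous fun g : absoluteGaloisGroup K ↦ g • m)
    (hdiv : ∀ m : M, ∃ m' : M, p • m' = m)
    (c : subgroupH1 (κ.kerSubgroup ⊓ decomp v) M) :
    ∃ c' : subgroupH1 (κ.kerSubgroup ⊓ decomp v) M, c = p • c' := by
  haveI := compactSpace_kerSubgroup_inf_decomp κ v
  exact exists_eq_nsmul_of_groupCdLE_one (Γ := ↥(κ.kerSubgroup ⊓ decomp v))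
    (fun m ↦ (hcont m).comp continuous_subtype_val) (groupCdLE_one_kerSubgroup_inf_decomp κ v hne) hdiv c

/-- **LRS_loc — `q_* : H¹(ker κ ⊓ D_v, N₂) → H¹(ker κ ⊓ D_v, N₃)` is onto** for every exact sequence
`0 → N₁ —j→ N₂ —q→ N₃ → 0` of discrete `Γ_K`-modules with continuous orbit maps and `N₁` `p`-primary
(e.g. the residual pair `0 → 𝔽(ω̃) → E_K[p] → 𝔽(𝟙̃) → 0`), at every finite `v` that does not split
completely in `K_∞`. V21 index road, step (3): the last `0` of
`P⁰(N_f) → P⁰(N_1) → P¹(N_ω) → P¹(N_f) → P¹(N_1) → 0`. [cite: SerreGaloisCohomology1997, I §2.2, II §3.3 Prop. 9]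
[cite: KellerYin2024, proof of Thm. 1.4.1 (arXiv:2402.12781v2 §1.4, the local rows)] -/
theorem resH1Hom_id_surjective_inf_decomp (hne : ∃ τ ∈ decomp v, κ τ ≠ 1)
    {N₁ : Type} [AddCommGroup N₁] [DistribMulAction (absoluteGaloisGroup K) N₁] [TopologicalSpace N₁]
    [DiscreteTopology N₁]
    {N₂ : Type} [AddCommGroup N₂] [DistribMulAction (absoluteGaloisGroup K) N₂] [TopologicalSpace N₂]
    [DiscreteTopology N₂]
    {N₃ : Type} [AddCommGroup N₃] [DistribMulAction (absoluteGaloisGroup K) N₃] [TopologicalSpace N₃]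
    [DiscreteTopology N₃]
    (hcont₁ : ∀ n : N₁, Continuous fun g : absoluteGaloisGroup K ↦ g • n)
    (hcont₂ : ∀ n : N₂, Continuous fun g : absoluteGaloisGroup K ↦ g • n)
    (hcont₃ : ∀ n : N₃, Continuous fun g : absoluteGaloisGroup K ↦ g • n)
    (hN₁ : ∀ n : N₁, ∃ k : ℕ, p ^ k • n = 0)
    (j : N₁ →+ N₂) (hj : ∀ (g : absoluteGaloisGroup K) (n : N₁), j (g • n) = g • j n)
    (hinj : Function.Injective j)
    (q : N₂ →+ N₃) (hq : ∀ (g : absoluteGaloisGroup K) (n : N₂), q (g • n) = g • q n)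
    (hqj : ∀ n : N₁, q (j n) = 0) (hexact : ∀ n : N₂, q n = 0 → ∃ m : N₁, j m = n)
    (hsurj : Function.Surjective q) :
    Function.Surjective
      (resH1Hom (ContinuousMonoidHom.id ↥(κ.kerSubgroup ⊓ decomp v)) q
        (fun g n ↦ hq (g : absoluteGaloisGroup K) n)) := by
  haveI := compactSpace_kerSubgroup_inf_decomp κ v
  exact resH1Hom_id_surjective_of_groupCdLE_one (Γ := ↥(κ.kerSubgroup ⊓ decomp v))
    (groupCdLE_one_kerSubgroup_inf_decomp κ v hne)
    (fun n ↦ (hcont₁ n).comp continuous_subtype_val) (fun n ↦ (hcont₂ n).comp continuous_subtype_val)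
    (fun n ↦ (hcont₃ n).comp continuous_subtype_val) hN₁ j (fun g n ↦ hj (g : absoluteGaloisGroup K) n)
    hinj q _ hqj hexact hsurj

end Road

end Summit.BirchSwinnertonDyer.BirchSwinnertonDyer.Theorems.AnticyclotomicLocalCdOne

end
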